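import Summits.ValiantsHypothesis.ValiantsHypothesis.Theorems.KPlusLogSqLawTridiagonalRealStaticGlue
import Summits.ValiantsHypothesis.ValiantsHypothesis.Theorems.KPlusLogSqLawTridiagonalRealStaticDoublingSharp

/-!
# Route «KPlusLogSqLaw», crux `WeakLifting` (stmt-ValiantsHypothesis-19561) — REAL side of the tridiagonal sector:
# SUPERADDITIVITY OF CERTIFIED ROWS WITHOUT SIDE CONDITIONS — `B(m₁ + m₂) ≥ Z₁ + Z₂` for ANY two certified blocks (all sizes)

HONEST FRAMING.  Helper (`--supports stmt-ValiantsHypothesis-19561 --as helper`), seat val-sym-lift-p3 (g14), cell `pub-symmetroid`, 2026-08-28,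
α register (static definite symmetric tridiagonal monomial designs), LOWER side.  The glue law `StaticTridiagonalRealGlue.glue_row_noTransition`
asks that the product `N₁ · N₂` alternate along BOTH clusters, i.e. that each block's determinant have constant sign on the other block's
cluster; the instances (`…ElevenSeventeen`, `…ThirteenTwentyOne`) checked this by evaluation.  THIS FILE REMOVES THE SIDE CONDITIONS by rescaling
block 2 far enough (`eval_pathDet_rescale`): a nonzero real polynomial has constant sign on `(0, ε)` (order of vanishing at `0`,
`StaticTridiagonalRealDoubling.exists_eq_X_pow_mul_eval_ne_zero`) and beyond its largest root (finitely many roots), so for `λ` large the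
rescaled cluster of block 2 lies in `(0, ε)` below block 1's cluster, and block 2's determinant reads block 1's cluster beyond its own roots:
* `exists_const_sign_near_zero`, `exists_const_sign_at_top` — the two constant-sign windows of a nonzero polynomial;
* `superadditive_row` — for ANY two blocks with certified alternation lists `L₁`, `L₂` (≥ 2 points each, strictly increasing, positive) there
  are a scale `λ > 0`, a coupling exponent `F` and a link `β > 0` such that the design [block 1 | β X^F | block 2 rescaled by `λ`] of size
  `m₁ + m₂` has at least `(|L₁| − 1) + (|L₂| − 1)` distinct positive determinant zeros.  **Certified rows are superadditive:
  `B(m₁ + m₂) ≥ Z₁ + Z₂`, no side condition.**  (The extra transition `+1` of `glue_row` does need its two sign hypotheses.)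
Nothing here is an upper bound; nothing bears on `WeakLifting` / `TropicalB` (stmt-19771) in their windows, Conjecture B, the Door-A registers,
`MatrixDescartes` (stmt-ValiantsHypothesis-18050) or VP ≠ VNP.  [mechanism: this seat's glue law; folklore: finitely many roots, intermediate values]
-/

-- `Summit.ValiantsHypothesis.ValiantsHypothesis.…` repeats a component by the D-0017 layout (single-conjunct summit); the name is mandated.
set_option linter.dupNamespace false
set_option autoImplicit false

namespace Summit.ValiantsHypothesis.ValiantsHypothesis.Theorems.KPlusLogSqLaw.StaticTridiagonalRealGlue

open Polynomial Filter Topology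
open Summit.ValiantsHypothesis.ValiantsHypothesis.Theorems.KPlusLogSqLaw.StaticTridiagonalRealPotential (pathDet)
open Summit.ValiantsHypothesis.ValiantsHypothesis.Theorems.KPlusLogSqLaw.StaticTridiagonalRealDoubling (exists_eq_X_pow_mul_eval_ne_zero)
open Summit.ValiantsHypothesis.ValiantsHypothesis.Theorems.KPlusLogSqLaw.StaticTridiagonalRealLadder
  (ne_zero_of_isChain_alt isChain_alt_congr)
open Summit.ValiantsHypothesis.ValiantsHypothesis.Theorems.KPlusLogSqLaw.StaticTridiagonalRealJoin (ne_zero_of_alternates)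

/-! ### §1 Constant-sign windows of a nonzero polynomial -/

/-- Near `0⁺` a nonzero real polynomial has a constant nonzero sign: `s · P(x) > 0` for `x ∈ (0, ε)`. [folklore: order of vanishing] -/
theorem exists_const_sign_near_zero (P : ℝ[X]) (hP : P ≠ 0) :
    ∃ (s ε : ℝ), 0 < ε ∧ ∀ x : ℝ, 0 < x → x < ε → 0 < s * P.eval x := by
  obtain ⟨Q, hPQ, hQ0⟩ := exists_eq_X_pow_mul_eval_ne_zero P hP
  have hQc : ContinuousAt (fun x : ℝ => Q.eval 0 * Q.eval x) 0 :=
    (continuous_const.mul (Polynomial.continuous Q)).continuousAt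
  have h0 : (0 : ℝ) < Q.eval 0 * Q.eval 0 := mul_self_pos.mpr hQ0
  obtain ⟨ε, hε, hεQ⟩ := Metric.eventually_nhds_iff.mp (continuousAt_const.eventually_lt hQc h0)
  refine ⟨Q.eval 0, ε, hε, fun x hx hxε => ?_⟩
  have hQx : 0 < Q.eval 0 * Q.eval x := hεQ (by rw [Real.dist_eq, sub_zero, abs_of_pos hx]; exact hxε)
  have hPx : P.eval x = x ^ P.rootMultiplicity 0 * Q.eval x := by
    conv_lhs => rw [hPQ]
    simp only [eval_mul, eval_pow, eval_X]
  rw [hPx, mul_left_comm]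
  exact mul_pos (pow_pos hx _) hQx

/-- Beyond its roots a nonzero real polynomial has a constant nonzero sign: `s · P(x) > 0` for `x > M`. [folklore: finitely many roots] -/
theorem exists_const_sign_at_top (P : ℝ[X]) (hP : P ≠ 0) :
    ∃ (s M : ℝ), 0 < M ∧ ∀ x : ℝ, M < x → 0 < s * P.eval x := by
  classical
  -- a bound above all roots
  set M : ℝ := (P.roots.toFinset.sum fun r => |r|) + 1 with hM
  have hroot : ∀ r : ℝ, P.eval r = 0 → r < M := by
    intro r hr
    have hmem : r ∈ P.roots.toFinset := by
      rw [Multiset.mem_toFinset, mem_roots hP]; exact hr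
    have h1 : |r| ≤ P.roots.toFinset.sum fun r => |r| :=
      Finset.single_le_sum (f := fun r : ℝ => |r|) (fun _ _ => abs_nonneg _) hmem
    have h2 : r ≤ |r| := le_abs_self r
    linarith
  have hMpos : 0 < M := by
    have : 0 ≤ P.roots.toFinset.sum fun r => |r| := Finset.sum_nonneg fun _ _ => abs_nonneg _
    linarith
  refine ⟨P.eval M, M, hMpos, fun x hx => ?_⟩
  -- no root in `[M, x]`, so the sign at `x` is the sign at `M`
  have hM0 : P.eval M ≠ 0 := fun h => lt_irrefl _ (hroot M h)
  rcases lt_or_gt_of_ne hM0 with hneg | hpos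
  · have hx0 : P.eval x < 0 := by
      by_contra hcon
      push Not at hcon
      obtain ⟨r, hr, hr0⟩ := intermediate_value_Icc hx.le (Polynomial.continuous P).continuousOn ⟨hneg.le, hcon⟩
      exact absurd (hroot r hr0) (not_lt.mpr hr.1)
    exact mul_pos_of_neg_of_neg hneg hx0
  · have hx0 : 0 < P.eval x := by
      by_contra hcon
      push Not at hcon
      obtain ⟨r, hr, hr0⟩ := intermediate_value_Icc' hx.le (Polynomial.continuous P).continuousOn ⟨hcon, hpos.le⟩
      exact absurd (hroot r hr0) (not_lt.mpr hr.1)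
    exact mul_pos hpos hx0

/-! ### §2 Superadditivity of certified rows -/

section Free

variable (a₁ : ℕ → ℝ) (d₁ : ℕ → ℕ) (b₁ : ℕ → ℝ) (f₁ : ℕ → ℕ) (a₂ : ℕ → ℝ) (d₂ : ℕ → ℕ) (b₂ : ℕ → ℝ) (f₂ : ℕ → ℕ)

/-- **SUPERADDITIVITY OF CERTIFIED ROWS (no side condition, all sizes).**  If `N₁ = D_{n₁+1}` alternates in sign along a strictly increasing list
`x₁ :: y₁ :: l₁` of positive points and `N₂ = D_{n₂+1}` along `x₂ :: y₂ :: l₂`, then for some scale `λ > 0`, coupling exponent `F` and link `β > 0`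
the design [block 1 | β X^F | block 2 with coefficients `a₂ t · λ^{d₂ t}`, `b₂ t · λ^{f₂ t}`] of size `n₁ + n₂ + 2` has at least
`(|l₁| + 1) + (|l₂| + 1) = Z₁ + Z₂` distinct positive determinant zeros. [this seat] -/
theorem superadditive_row (n₁ n₂ : ℕ) (x₁ y₁ : ℝ) (l₁ : List ℝ) (x₂ y₂ : ℝ) (l₂ : List ℝ)
    (hlt₁ : (x₁ :: y₁ :: l₁).IsChain (· < ·)) (hpos₁ : ∀ u ∈ x₁ :: y₁ :: l₁, 0 < u)
    (halt₁ : (x₁ :: y₁ :: l₁).IsChain (fun x y => (pathDet a₁ d₁ b₁ f₁ (n₁ + 1)).eval x * (pathDet a₁ d₁ b₁ f₁ (n₁ + 1)).eval y < 0))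
    (hlt₂ : (x₂ :: y₂ :: l₂).IsChain (· < ·)) (hpos₂ : ∀ u ∈ x₂ :: y₂ :: l₂, 0 < u)
    (halt₂ : (x₂ :: y₂ :: l₂).IsChain (fun x y => (pathDet a₂ d₂ b₂ f₂ (n₂ + 1)).eval x * (pathDet a₂ d₂ b₂ f₂ (n₂ + 1)).eval y < 0)) :
    ∃ (lam : ℝ) (F : ℕ) (β : ℝ), 0 < lam ∧ 0 < β ∧ (l₁.length + 1) + (l₂.length + 1) ≤
      ((pathDet (fun t => if t ≤ n₁ then a₁ t else (fun t => a₂ t * lam ^ d₂ t) (t - (n₁ + 1)))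
        (fun t => if t ≤ n₁ then d₁ t else d₂ (t - (n₁ + 1)))
        (fun t => if t < n₁ then b₁ t else if t = n₁ then β else (fun t => b₂ t * lam ^ f₂ t) (t - (n₁ + 1)))
        (fun t => if t < n₁ then f₁ t else if t = n₁ then F else f₂ (t - (n₁ + 1))) (n₁ + n₂ + 2)).roots.toFinset.filter
          (fun t => 0 < t)).card := by
  set N₁ := pathDet a₁ d₁ b₁ f₁ (n₁ + 1) with hN₁
  set N₂ := pathDet a₂ d₂ b₂ f₂ (n₂ + 1) with hN₂
  have hN₁0 : N₁ ≠ 0 := ne_zero_of_alternates N₁ (by simp) halt₁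
  have hN₂0 : N₂ ≠ 0 := ne_zero_of_alternates N₂ (by simp) halt₂
  -- the two constant-sign windows
  obtain ⟨s₁, ε, hε, hs₁⟩ := exists_const_sign_near_zero N₁ hN₁0
  obtain ⟨s₂, M, hM, hs₂⟩ := exists_const_sign_at_top N₂ hN₂0
  -- bounds of the certificate lists
  have hx₁ : 0 < x₁ := hpos₁ x₁ (by simp)
  have hx₂ : 0 < x₂ := hpos₂ x₂ (by simp)
  have hpw₁ := List.isChain_iff_pairwise.mp hlt₁
  have hpw₂ := List.isChain_iff_pairwise.mp hlt₂
  have hge₁ : ∀ u ∈ x₁ :: y₁ :: l₁, x₁ ≤ u := fun u hu => by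
    rcases List.mem_cons.mp hu with rfl | hu
    · exact le_rfl
    · exact (List.rel_of_pairwise_cons hpw₁ hu).le
  set S₂ : ℝ := (x₂ :: y₂ :: l₂).sum with hS₂
  have hle₂ : ∀ u ∈ x₂ :: y₂ :: l₂, u ≤ S₂ := fun u hu =>
    List.single_le_sum (fun v hv => (hpos₂ v hv).le) u hu
  have hS₂pos : 0 < S₂ := hx₂.trans_le (hle₂ x₂ (by simp))
  -- the scale: `λ > S₂/ε`, `λ > S₂/x₁`, `λ > M/x₁`
  set lam : ℝ := S₂ / ε + S₂ / x₁ + M / x₁ + 1 with hlam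
  have hlam₁ : S₂ / ε < lam := by
    have : 0 < S₂ / x₁ := div_pos hS₂pos hx₁
    have : 0 < M / x₁ := div_pos hM hx₁
    linarith
  have hlam₂ : S₂ / x₁ < lam := by
    have : 0 < S₂ / ε := div_pos hS₂pos hε
    have : 0 < M / x₁ := div_pos hM hx₁
    linarith
  have hlam₃ : M / x₁ < lam := by
    have : 0 < S₂ / ε := div_pos hS₂pos hε
    have : 0 < S₂ / x₁ := div_pos hS₂pos hx₁
    linarith
  have hlam : 0 < lam := (div_pos hS₂pos hε).trans hlam₁
  -- rescaled block 2 and its cluster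
  have hev₂ : ∀ x : ℝ, (pathDet (fun t => a₂ t * lam ^ d₂ t) d₂ (fun t => b₂ t * lam ^ f₂ t) f₂ (n₂ + 1)).eval x = N₂.eval (lam * x) :=
    fun x => eval_pathDet_rescale a₂ d₂ b₂ f₂ lam x (n₂ + 1)
  -- scaled points `u / λ` are in `(0, ε)` and below `x₁`
  have hsmall : ∀ u ∈ x₂ :: y₂ :: l₂, 0 < u / lam ∧ u / lam < ε ∧ u / lam < x₁ := by
    intro u hu
    have hu0 := hpos₂ u hu
    have huS := hle₂ u hu
    refine ⟨div_pos hu0 hlam, ?_, ?_⟩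
    · rw [div_lt_iff₀ hlam]
      have : S₂ < ε * lam := by
        have h := (div_lt_iff₀ hε).mp hlam₁
        linarith [h]
      nlinarith
    · rw [div_lt_iff₀ hlam]
      have h := (div_lt_iff₀ hx₁).mp hlam₂
      nlinarith
  -- block 1's points read block 2 beyond its roots: `λ u > M`
  have hbig : ∀ u ∈ x₁ :: y₁ :: l₁, M < lam * u := by
    intro u hu
    have h := (div_lt_iff₀ hx₁).mp hlam₃
    have hu := hge₁ u hu
    nlinarith
  -- the product alternates along both clusters
  set p : ℝ → ℝ := fun x => N₁.eval x * (pathDet (fun t => a₂ t * lam ^ d₂ t) d₂ (fun t => b₂ t * lam ^ f₂ t) f₂ (n₂ + 1)).eval x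
    with hp
  have haltA : ((x₂ :: y₂ :: l₂).map (fun u => u / lam)).IsChain (fun x y => p x * p y < 0) := by
    rw [List.isChain_map]
    refine (isChain_alt_congr (c := s₁) (f := fun u => N₂.eval u) fun u hu => ?_).mp halt₂
    obtain ⟨h0, hεu, -⟩ := hsmall u hu
    have h1 := hs₁ (u / lam) h0 hεu
    have h2 : N₂.eval u ≠ 0 := ne_zero_of_isChain_alt halt₂ u hu
    simp only [hp, hev₂, mul_div_cancel₀ u hlam.ne']
    have : s₁ * (N₂.eval u * (N₁.eval (u / lam) * N₂.eval u)) = (s₁ * N₁.eval (u / lam)) * N₂.eval u ^ 2 := by ring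
    rw [this]
    exact mul_pos h1 (by positivity)
  have haltB : (x₁ :: y₁ :: l₁).IsChain (fun x y => p x * p y < 0) := by
    refine (isChain_alt_congr (c := s₂) (f := fun u => N₁.eval u) fun u hu => ?_).mp halt₁
    have h1 := hs₂ (lam * u) (hbig u hu)
    have h2 : N₁.eval u ≠ 0 := ne_zero_of_isChain_alt halt₁ u hu
    simp only [hp, hev₂]
    have : s₂ * (N₁.eval u * (N₁.eval u * N₂.eval (lam * u))) = (s₂ * N₂.eval (lam * u)) * N₁.eval u ^ 2 := by ring
    rw [this]
    exact mul_pos h1 (by positivity)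
  -- the combined strictly increasing list
  have hchain : ((x₂ :: y₂ :: l₂).map (fun u => u / lam) ++ x₁ :: y₁ :: l₁).IsChain (· < ·) := by
    rw [List.isChain_append]
    refine ⟨?_, hlt₁, ?_⟩
    · rw [List.isChain_map]
      exact hlt₂.imp fun a b (hab : a < b) => div_lt_div_of_pos_right hab hlam
    · intro u hu v hv
      simp only [List.head?_cons, Option.mem_def, Option.some.injEq] at hv
      subst hv
      -- `u` is the last scaled point
      have hu' : u ∈ (x₂ :: y₂ :: l₂).map (fun u => u / lam) := List.mem_of_getLast? hu
      obtain ⟨w, hw, rfl⟩ := List.mem_map.mp hu'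
      exact (hsmall w hw).2.2
  obtain ⟨F, β, hβ, hcount⟩ := glue_row_noTransition a₁ d₁ b₁ f₁ (fun t => a₂ t * lam ^ d₂ t) d₂ (fun t => b₂ t * lam ^ f₂ t) f₂
    n₁ n₂ (x₂ / lam) ((y₂ :: l₂).map (fun u => u / lam)) (by simp) x₁ (y₁ :: l₁) (by simp)
    (by simpa using hchain) (div_pos hx₂ hlam) (by simpa using haltA) haltB
  refine ⟨lam, F, β, hlam, hβ, ?_⟩
  simp only [List.length_map, List.length_cons] at hcount
  have e : l₂.length + 1 + (l₁.length + 1) = l₁.length + 1 + (l₂.length + 1) := by ring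
  rw [← e]
  exact hcount

end Free

end Summit.ValiantsHypothesis.ValiantsHypothesis.Theorems.KPlusLogSqLaw.StaticTridiagonalRealGlue
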